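import Literature.IUT.HodgeArakelov.ThetaEvaluationSettingModelProofs
import Literature.IUT.HodgeArakelov.ThetaEvaluationSettingIotaProofs

/-!
# [IUTchII] Prop 2.2 (ii)′ at the MODEL — one closing theorem with the consolidated residual inputs (sixth
# proof-only companion)

Proof-only companion (abc-iut cell, D-0067 wave 4, cone of [IUTchIII] Cor. 3.12; node **IUTchII:Prop2.2(ii)**; no
definitions). S. Mochizuki, *Inter-universal Teichmüller theory II*, kurims manuscript (Dec. 2020) §2, Prop. 2.2 (ii)
p. 66 (claim key `Mochizuki2012`, DISPUTED, D-0012); [EtTh] Prop. 1.4 (i)–(iii) pp. 20–22, Def. 2.7 p. 41. Nothing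
here takes a side on [IUTchIII] Cor. 3.12.

ASSEMBLY of `ThetaEvaluationSettingModelProofs.lean` (`prop22_ii'_etaleThetaDataOfSetting`: `τ`, `hτ0`, `hdesc`
discharged at `D := etaleThetaDataOfSetting'`) with `ThetaEvaluationSettingIotaProofs.lean` (`hrev_of_transport`,
`horbit_of_transport`: `hrev`, `horbit` reduced to inputs on the automorphism pair). The single closing theorem
`prop22_ii'_model` lists EXACTLY the residual printed inputs (plan/GAP-LEDGER.md D-G-w4d010-2d):
(R1) the model pointed-inversion PAIR `(α, β)` — compatible with `φ` and `l·Δ_Θ`, stabilising `Π^tp_Ÿ̲̲`, REVERSING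
the `ℤ`-torsor (`toLZ (α γ) = −1`, [IUTchII] Rmk. 2.1.1 (i)) — with its actions `ρ` (intertwining abc-iut-L6-t1's
`h1TopAut` through `h1Top`) and `ρlim` (compatible); (R2) [EtTh] Prop. 1.4 (ii) at the CLASS level: `ε` moves the
root class `η̲̈^Θ` by a class of order dividing `2` (`hsign`, "`Θ̈(−Ü) = −Θ̈(Ü)`") and `ι` carries it to a
`Π^tp_Y̲̲`-conjugate (`hroot`, "`Θ̈(Ü) = −Θ̈(Ü⁻¹)`"); (R3) [EtTh] Prop. 1.4 (i)/(iii) at the class level: distinct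
`γ`-translates of `η̲̈^Θ` differ by non-torsion classes (`hfree`). typed ≠ proved for (R1)–(R3).
-/

namespace Literature.IUT.HodgeArakelov

open Literature.AnabelianGeometry.EtaleTheta (ContH1)
open EtaleThetaDataOfSetting

noncomputable section

variable {p : ℕ} [Fact p.Prime] {D : Literature.AnabelianGeometry.EtaleTheta.ThetaSetting p}
  {E : D.EtaleThetaData} {l : ℕ} (C : E.DoubleUnderline l) [hN : (PiYdd C).Normal]

/-- **IUTchII:Prop2.2(ii)′ at the model `Π_v := Π^tp_X̲̲` — closing theorem** (kurims p. 66: "determines a specific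
`μ_{2l}`-orbit `θ^ι(Π_v) ⊆ θ(Π_v)` within the unique `{(l·ℤ)×μ_{2l}}`-orbit"): for `D := etaleThetaDataOfSetting'`
(abc-iut-L6-t1) and any Prop. 2.2 (i) datum `Dec` over it, the repaired `Prop22_ii' Dec` HOLDS given exactly:
(R1) an automorphism pair `(α, β)` of `(Π^tp_X̲̲, (Π^tp_X)^Θ)` compatible with `φ` and `l·Δ_Θ`, stabilising `Π^tp_Ÿ̲̲`,
with `toLZ (α γ) = −1` for a `toLZ`-generator `γ` (the model pointed inversion: it reverses the `ℤ`-torsor of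
components, Rmk. 2.1.1 (i)), an additive automorphism `ρ` of `H¹` intertwining its transport `h1TopAut` through
`h1Top`, and a compatible `ρlim` on the limit; (R2) [EtTh] Prop. 1.4 (ii) at the class level — `ε ∈ Π^tp_Y̲̲ ∖ Π^tp_Ÿ̲̲`
moves the root class `η̲̈^Θ` by a class `κ` with `κ² = 1`, and `ι` carries `η̲̈^Θ` to a `Π^tp_Y̲̲`-conjugate of itself;
(R3) [EtTh] Prop. 1.4 (i)/(iii) at the class level — distinct `γ`-translates of `η̲̈^Θ` differ by non-torsion classes.
Everything else — the `(l·ℤ)×μ₂`-description of the orbit, `ι` reversing the translates up to torsion, `ι`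
stabilising the orbit, the torsion bookkeeping of `θ(Π_v)`, the `μ_{2l}`-orbit clause — is PROVED
(`prop22_ii'_etaleThetaDataOfSetting`, `hrev_of_transport`, `horbit_of_transport`, `prop22_ii'_of_translates`).
[claim: Mochizuki2012, status: disputed] (IUTchII §2 Prop 2.2 (ii), kurims pp.65-67) -/
theorem prop22_ii'_model (hC : D.Compat) (hS : D.Sec2Hyps) (hchar : PiYddCharacteristic C)
    (S : BadPlaceSetting.{0}) (eS : (Pi C) ≃ₜ* S.PiX) (hl : S.l = l)
    {T : TemperedCoverings S (Pi C)}
    (Dec : SubgraphDecomposition S T (etaleThetaDataOfSetting' C hC hS hchar S.toThetaSetting eS hl))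
    -- (R1) the model pointed-inversion pair and its actions
    (α : (Pi C) ≃ₜ* (Pi C)) (β : D.GtpTheta ≃ₜ* D.GtpTheta) (hφ : ∀ g, β (phi C g) = phi C (α g))
    (hA : ∀ a : D.GtpTheta, a ∈ D.lDeltaTheta l → β a ∈ D.lDeltaTheta l)
    (hH : ∀ x, x ∈ PiYdd C ↔ α x ∈ PiYdd C)
    (γ ε : Pi C) (hγ : C.toLZ γ = Multiplicative.ofAdd 1) (hε₁ : (ε : D.PiTemp) ∈ D.GtpY)
    (hε₂ : (ε : D.PiTemp) ∉ D.GtpYdd) (hαγ : C.toLZ (α γ) = Multiplicative.ofAdd (-1))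
    (ρ : (coh C).H1 ⊤ ≃+ (coh C).H1 ⊤) (ρlim : (coh C).lim ≃+ (coh C).lim)
    (hcompat : ∀ x, (coh C).toLim ⊤ (ρ x) = ρlim ((coh C).toLim ⊤ x))
    (hρT : ∀ x, ρ ((h1Top C).symm (Additive.ofMul x)) =
      (h1Top C).symm (Additive.ofMul (h1TopAut (phi C) (D.lDeltaTheta l) (PiYdd C) α β hφ hA hH x)))
    -- (R2) [EtTh] Prop. 1.4 (ii) at the class level: the signs of `ε` and of `ι` on the root class
    (hsign : ∃ κ : ContH1 (phi C) (D.lDeltaTheta l) (PiYdd C ⊓ ⊤), κ ^ 2 = 1 ∧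
      ContH1.conj (phi C) (D.lDeltaTheta l) ε (rootLiftClass C) = rootLiftClass C * κ)
    (hroot : ∃ τ₀ : Pi C, (τ₀ : D.PiTemp) ∈ D.GtpY ∧
      h1TopAut (phi C) (D.lDeltaTheta l) (PiYdd C) α β hφ hA hH (rootLiftClass C) =
        ContH1.conj (phi C) (D.lDeltaTheta l) τ₀ (rootLiftClass C))
    -- (R3) [EtTh] Prop. 1.4 (i)/(iii) at the class level: distinct translates differ by non-torsion classes
    (hfree : ∀ m n : ℤ, IsOfFinAddOrder
      ((h1Top C).symm (Additive.ofMul (ContH1.conj (phi C) (D.lDeltaTheta l) (γ ^ m) (rootLiftClass C))) -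
        (h1Top C).symm (Additive.ofMul (ContH1.conj (phi C) (D.lDeltaTheta l) (γ ^ n) (rootLiftClass C)))) →
      m = n) :
    Prop22_ii' Dec := by
  obtain ⟨τ₀, hτ₀Y, hτ₀⟩ := hroot
  -- `ι` moves the root class by a class of finite order (from (R2): `τ₀ ∈ Π^tp_Y̲̲`)
  have hιsign : ∃ κ' : ContH1 (phi C) (D.lDeltaTheta l) (PiYdd C ⊓ ⊤), IsOfFinOrder κ' ∧
      h1TopAut (phi C) (D.lDeltaTheta l) (PiYdd C) α β hφ hA hH (rootLiftClass C) = rootLiftClass C * κ' := by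
    obtain ⟨t, ht, h⟩ := conj_rootLiftClass_of_mem_GtpY C hS ε hε₁ hε₂ hsign τ₀ hτ₀Y
    exact ⟨t, ht, hτ₀.trans h⟩
  exact prop22_ii'_etaleThetaDataOfSetting C hC hS hchar S eS hl Dec ρ ρlim hcompat
    (horbit_of_transport C hC α β hφ hA hH ρ hρT ⟨τ₀, hτ₀⟩) γ ε hγ hε₁ hε₂ hsign
    (hrev_of_transport C hS γ ε hγ hε₁ hε₂ hsign α β hφ hA hH hαγ hιsign ρ hρT) hfree

/-- The hypothesis `hfree` of `prop22_ii'_model` ("distinct `γ`-translates of the root class differ by non-torsion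
classes") in its canonical (R3) shape: it FOLLOWS from "for `k ≠ 0` the class `(γᵏ·η̲̈)·η̲̈⁻¹` is not of finite
order" ([EtTh] Prop. 1.4 (i)/(iii) p. 20–22 at the class level: `γᵏ·η̲̈` and `η̲̈` are the Kummer classes of
functions with DIFFERENT divisors of poles, so their ratio is a non-constant function) — since
`γᵐ·η̲̈ · (γⁿ·η̲̈)⁻¹ = γⁿ·((γᵐ⁻ⁿ·η̲̈)·η̲̈⁻¹)` and conjugation and the comparison `h1Top` preserve (non-)torsion.
[claim: Mochizuki2012, status: disputed] (IUTchII §2 Prop 2.2 (ii), kurims p.66) -/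
theorem hfree_of_translate_not_isOfFinOrder (γ : Pi C)
    (hk : ∀ k : ℤ, k ≠ 0 → ¬ IsOfFinOrder
      (ContH1.conj (phi C) (D.lDeltaTheta l) (γ ^ k) (rootLiftClass C) * (rootLiftClass C)⁻¹))
    (m n : ℤ) (hmn : IsOfFinAddOrder
      ((h1Top C).symm (Additive.ofMul (ContH1.conj (phi C) (D.lDeltaTheta l) (γ ^ m) (rootLiftClass C))) -
        (h1Top C).symm (Additive.ofMul (ContH1.conj (phi C) (D.lDeltaTheta l) (γ ^ n) (rootLiftClass C))))) :
    m = n := by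
  by_contra hne
  apply hk (m - n) (sub_ne_zero.mpr hne)
  -- pull `hmn` back through `h1Top` and `Additive.ofMul`
  rw [← map_sub, ← ofMul_div, div_eq_mul_inv] at hmn
  have h1 : IsOfFinOrder (ContH1.conj (phi C) (D.lDeltaTheta l) (γ ^ m) (rootLiftClass C) *
      (ContH1.conj (phi C) (D.lDeltaTheta l) (γ ^ n) (rootLiftClass C))⁻¹) := by
    have h := ((h1Top C).toAddMonoidHom).isOfFinAddOrder hmn
    rw [AddEquiv.coe_toAddMonoidHom, AddEquiv.apply_symm_apply] at h
    exact (isOfFinAddOrder_ofMul_iff).mp h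
  -- `γᵐ·η · (γⁿ·η)⁻¹ = γⁿ·((γᵐ⁻ⁿ·η)·η⁻¹)`
  have h2 : ContH1.conj (phi C) (D.lDeltaTheta l) (γ ^ m) (rootLiftClass C) *
        (ContH1.conj (phi C) (D.lDeltaTheta l) (γ ^ n) (rootLiftClass C))⁻¹ =
      ContH1.conj (phi C) (D.lDeltaTheta l) (γ ^ n)
        (ContH1.conj (phi C) (D.lDeltaTheta l) (γ ^ (m - n)) (rootLiftClass C) * (rootLiftClass C)⁻¹) := by
    rw [map_mul, map_inv, ← ContH1.conj_mul_apply, ← zpow_add, add_sub_cancel]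
  rw [h2] at h1
  have h3 := (ContH1.conj (phi C) (D.lDeltaTheta l) (γ ^ n)⁻¹).isOfFinOrder h1
  rwa [ContH1.conj_inv_conj_apply] at h3

end

end Literature.IUT.HodgeArakelov
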